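import Literature.NumberTheory.DiophantineGeometry.GenEllAnnulus
import HarnessLib

/-!
# [GenEll] Thm. 2.1 (ii) at `Σ = {2}` is not vacuous: it is abc for balanced, `2`-tame triples

S. Mochizuki, *Arithmetic elliptic curves in general position*, Math. J. Okayama Univ. 52 (2010)
[cite: MochizukiGenEll2010, Thm 2.1 (ii) p.11]. Proof-only companion of `GenEllThm21` /
`GenEllAnnulus` (support file for the route item `GenEllTwo` =
`ABCCompactlyBounded {2} → ∀ d > 0, VojtaP1Deg d`; no new definitions, no new facts).

STRENGTH AUDIT of the typed hypothesis `ABCCompactlyBounded {2}` (the planner's `why_might_fail`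
for `GenEllTwo`: "the `{2}`-instance must survive the same audit" as A-Sd2-F1, where
`ABCCompactlyBounded {4}` was found VACUOUSLY TRUE because no `CBData` has a non-prime in its
support). For `Σ = {2}` the hypothesis is NOT vacuous, kernel-checked here:

* `log_le_of_abcCompactlyBounded_two` — `ABCCompactlyBounded {2}` implies, for every `ε > 0` and
  every `0 < ρ ≤ 1/2`, the abc inequality `log c ≤ (1+ε)·log rad(abc) + C` uniformly on all abc
  triples `(a, b, c)` that are `ρ`-BALANCED (`a, b > ρ·c`) and `2`-TAME (`2^{v₂(a)}, 2^{v₂(b)},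
  2^{v₂(c)} ≤ ρ⁻¹`) — because the point `λ = a/c ∈ U_P(ℚ)` of such a triple is `ρ`-far from the
  cusps at `∞` and at `2` (`farFromCusps_ratPoint_triple`), hence lies in the annulus compactly
  bounded subset with support `{∞, 2}` (`GenEllAnnulus`), where statement (ii) applies
  (`vojtaIneq_farFromCusps_two`) and the abc dictionary (`ht_ratPoint_triple`, `logDiff_ratPoint`,
  `logCond_ratPoint_triple`) translates it;
* `abc_tame_of_abcCompactlyBounded_two` — the same in the multiplicative form of the summit
  sentence, `c < C · rad(abc)^{1+ε}`, on that family;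
* `log_le_family_of_abcCompactlyBounded_two` — the instance along the explicit infinite family
  `(4m+1, 4m+2, 8m+3)` (a `1/4`-balanced, `2`-tame abc triple for every `m`, with `c = 8m+3`
  unbounded): so the restricted statement has content — an open assertion of abc type on
  infinitely many triples, not a triviality.

So, AS TYPED, the antecedent of `GenEllTwo` carries abc-type content on an explicit infinite family,
and its consequent implies the full abc sentence (`abc_of_vojtaP1Deg`, landed): the item is a
genuine implication between two open statements, as [GenEll] Thm. 2.1 (ii) ⟹ (i) is in print.
Nothing here bears on [IUTchIII] Cor. 3.12; [GenEll] Thm. 2.1 is classical and undisputed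
(Scholze–Stix 2018 §1.2).
-/

noncomputable section

open NumberField

namespace Literature.NumberTheory.DiophantineGeometry.GenEll

/-! ## `p`-adic and archimedean sizes of the point `a/c` of a triple -/

section Norms

variable {p : ℕ} [Fact p.Prime]

/-- `‖n‖ = p^{-v_p(n)}` in `Q̄_p` for a natural number `n ≠ 0`. [folklore] -/
private theorem norm_natCast_padicAlgCl {n : ℕ} (hn : n ≠ 0) :
    ‖(n : PadicAlgCl p)‖ = ((p : ℝ) ^ padicValNat p n)⁻¹ := by
  rw [← map_natCast (algebraMap ℚ_[p] (PadicAlgCl p)) n]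
  change ‖((n : ℚ_[p]) : PadicAlgCl p)‖ = _
  rw [PadicAlgCl.norm_extends p,
    Padic.norm_eq_zpow_neg_valuation (Nat.cast_ne_zero.mpr hn), Padic.valuation_natCast,
    zpow_neg, zpow_natCast]

/-- `p^{-v_p(n)} ≤ 1`. [folklore] -/
private theorem norm_natCast_padicAlgCl_le_one {n : ℕ} (hn : n ≠ 0) :
    ‖(n : PadicAlgCl p)‖ ≤ 1 := by
  rw [norm_natCast_padicAlgCl hn]
  have hp : (1 : ℝ) ≤ (p : ℝ) ^ padicValNat p n :=
    one_le_pow₀ (by exact_mod_cast (Fact.out : p.Prime).one_lt.le)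
  exact inv_le_one_of_one_le₀ hp

/-- Tameness `p^{v_p(n)} ≤ ρ⁻¹` gives `ρ ≤ ‖n‖` in `Q̄_p`. [folklore] -/
private theorem le_norm_natCast_padicAlgCl_of_tame {n : ℕ} (hn : n ≠ 0) {ρ : ℝ} (h0 : 0 < ρ)
    (ht : (p : ℝ) ^ padicValNat p n ≤ ρ⁻¹) : ρ ≤ ‖(n : PadicAlgCl p)‖ := by
  rw [norm_natCast_padicAlgCl hn]
  have hpow : 0 < (p : ℝ) ^ padicValNat p n :=
    pow_pos (by exact_mod_cast (Fact.out : p.Prime).pos) _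
  rw [le_inv_comm₀ h0 hpow]
  exact ht

/-- A ring homomorphism `ℚ → Q̄_p` sends `a/c` to `a/c`, of norm `‖a‖/‖c‖`. [folklore] -/
private theorem norm_ringHom_div_padicAlgCl (σ : ℚ →+* PadicAlgCl p) (a c : ℕ) :
    ‖σ ((a : ℚ) / c)‖ = ‖(a : PadicAlgCl p)‖ / ‖(c : PadicAlgCl p)‖ := by
  rw [map_div₀, map_natCast, map_natCast, norm_div]

/-- … and `a/c - 1 = -(b/c)` for `a + b = c`, of norm `‖b‖/‖c‖`. [folklore] -/
private theorem norm_ringHom_div_sub_one_padicAlgCl (σ : ℚ →+* PadicAlgCl p) {a b c : ℕ}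
    (habc : a + b = c) (hc : c ≠ 0) :
    ‖σ ((a : ℚ) / c) - 1‖ = ‖(b : PadicAlgCl p)‖ / ‖(c : PadicAlgCl p)‖ := by
  have hc' : (c : PadicAlgCl p) ≠ 0 := Nat.cast_ne_zero.mpr hc
  have h : σ ((a : ℚ) / c) - 1 = -((b : PadicAlgCl p) / c) := by
    rw [map_div₀, map_natCast, map_natCast]
    have : (c : PadicAlgCl p) = a + b := by exact_mod_cast habc.symm
    field_simp
    rw [this]; ring
  rw [h, norm_neg, norm_div]

/-- A ring homomorphism `ℚ → ℂ` sends `a/c` to a complex number of norm `a/c`. [folklore] -/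
private theorem norm_ringHom_div_complex (σ : ℚ →+* ℂ) (a c : ℕ) :
    ‖σ ((a : ℚ) / c)‖ = (a : ℝ) / c := by
  rw [map_div₀, map_natCast, map_natCast, norm_div, Complex.norm_natCast, Complex.norm_natCast]

/-- … and `‖σ(a/c) - 1‖ = b/c` for `a + b = c`. [folklore] -/
private theorem norm_ringHom_div_sub_one_complex (σ : ℚ →+* ℂ) {a b c : ℕ} (habc : a + b = c)
    (hc : c ≠ 0) : ‖σ ((a : ℚ) / c) - 1‖ = (b : ℝ) / c := by
  have hc' : (c : ℂ) ≠ 0 := Nat.cast_ne_zero.mpr hc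
  have h : σ ((a : ℚ) / c) - 1 = -((b : ℂ) / c) := by
    rw [map_div₀, map_natCast, map_natCast]
    have : (c : ℂ) = a + b := by exact_mod_cast habc.symm
    field_simp
    rw [this]; ring
  rw [h, norm_neg, norm_div, Complex.norm_natCast, Complex.norm_natCast]

end Norms

/-! ## Balanced, `2`-tame triples are far from the cusps at `∞` and at `2` -/

variable {a b c : ℕ}

/-- **The point `λ = a/c` of a `ρ`-balanced, `2`-tame abc triple is `ρ`-far from the cusps `0, 1, ∞`
at `∞` and at `2`** (`0 < ρ ≤ 1/2`): at `∞`, `|a/c| = a/c ∈ (ρ, 1) ⊂ (ρ, ρ⁻¹)` and `|a/c − 1| = b/c > ρ`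
by balance; at `2`, `‖a‖₂, ‖b‖₂, ‖c‖₂ ∈ [ρ, 1]` by tameness, so `‖a/c‖₂ ∈ [ρ, ρ⁻¹]` and
`‖a/c − 1‖₂ = ‖b/c‖₂ ≥ ρ`. [cite: MochizukiGenEll2010, Ex 1.3 (ii) p.6] -/
theorem farFromCusps_ratPoint_triple (h : IsABCTriple a b c) {ρ : ℝ} (h0 : 0 < ρ) (h2 : ρ ≤ 1 / 2)
    (hca : ρ * c < a) (hcb : ρ * c < b) (h2a : (2 : ℝ) ^ padicValNat 2 a ≤ ρ⁻¹)
    (h2b : (2 : ℝ) ^ padicValNat 2 b ≤ ρ⁻¹) (h2c : (2 : ℝ) ^ padicValNat 2 c ≤ ρ⁻¹) :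
    (ratPoint ((a : ℚ) / c)).FarFromCusps ({2} : Finset ℕ) ρ := by
  obtain ⟨ha, hb, habc, -⟩ := h
  have hc : c ≠ 0 := by omega
  have hcR : (0 : ℝ) < c := by exact_mod_cast Nat.pos_of_ne_zero hc
  have hρ1 : ρ < 1 := lt_of_le_of_lt h2 (by norm_num)
  have i1 : ρ < (a : ℝ) / c := by rw [lt_div_iff₀ hcR]; exact hca
  have i2 : (a : ℝ) / c < ρ⁻¹ := by
    have hac : (a : ℝ) / c < 1 := by
      rw [div_lt_one hcR]; exact_mod_cast (show a < c by omega)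
    exact hac.trans (one_lt_inv_iff₀.mpr ⟨h0, hρ1⟩)
  have i3 : ρ < (b : ℝ) / c := by rw [lt_div_iff₀ hcR]; exact hcb
  unfold NFPoint.FarFromCusps
  dsimp only [ratPoint]
  refine ⟨fun σ => ?_, fun p hp _ σ => ?_⟩
  · -- archimedean place: `σ : ℚ →+* ℂ`
    have e1 : ‖σ ((a : ℚ) / c)‖ = (a : ℝ) / c := norm_ringHom_div_complex σ a c
    have e2 : ‖σ ((a : ℚ) / c) - 1‖ = (b : ℝ) / c := norm_ringHom_div_sub_one_complex σ habc hc
    exact ⟨i1.trans_eq e1.symm, e1.trans_lt i2, i3.trans_eq e2.symm⟩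
  · -- the place `2`: `σ : ℚ →+* Q̄_2`
    rw [Finset.mem_singleton] at hp
    subst hp
    have e1 : ‖σ ((a : ℚ) / c)‖ = ‖(a : PadicAlgCl 2)‖ / ‖(c : PadicAlgCl 2)‖ :=
      norm_ringHom_div_padicAlgCl σ a c
    have e2 : ‖σ ((a : ℚ) / c) - 1‖ = ‖(b : PadicAlgCl 2)‖ / ‖(c : PadicAlgCl 2)‖ :=
      norm_ringHom_div_sub_one_padicAlgCl σ habc hc
    have hna := le_norm_natCast_padicAlgCl_of_tame (p := 2) ha.ne' h0 (by exact_mod_cast h2a)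
    have hnb := le_norm_natCast_padicAlgCl_of_tame (p := 2) hb.ne' h0 (by exact_mod_cast h2b)
    have hnc := le_norm_natCast_padicAlgCl_of_tame (p := 2) hc h0 (by exact_mod_cast h2c)
    have hna1 := norm_natCast_padicAlgCl_le_one (p := 2) ha.ne'
    have hnb1 := norm_natCast_padicAlgCl_le_one (p := 2) hb.ne'
    have hnc1 := norm_natCast_padicAlgCl_le_one (p := 2) hc
    have hncpos : 0 < ‖(c : PadicAlgCl 2)‖ := h0.trans_le hnc
    have j1 : ρ ≤ ‖(a : PadicAlgCl 2)‖ / ‖(c : PadicAlgCl 2)‖ := by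
      rw [le_div_iff₀ hncpos]
      exact (mul_le_of_le_one_right h0.le hnc1).trans hna
    have j2 : ‖(a : PadicAlgCl 2)‖ / ‖(c : PadicAlgCl 2)‖ ≤ ρ⁻¹ := by
      rw [div_le_iff₀ hncpos]
      calc ‖(a : PadicAlgCl 2)‖ ≤ 1 := hna1
        _ = ρ⁻¹ * ρ := (inv_mul_cancel₀ h0.ne').symm
        _ ≤ ρ⁻¹ * ‖(c : PadicAlgCl 2)‖ := mul_le_mul_of_nonneg_left hnc (inv_nonneg.mpr h0.le)
    have j3 : ρ ≤ ‖(b : PadicAlgCl 2)‖ / ‖(c : PadicAlgCl 2)‖ := by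
      rw [le_div_iff₀ hncpos]
      exact (mul_le_of_le_one_right h0.le hnc1).trans hnb
    exact ⟨j1.trans_eq e1.symm, e1.trans_le j2, j3.trans_eq e2.symm⟩

/-! ## Statement (ii) at `Σ = {2}` on balanced, `2`-tame triples -/

/-- **`ABCCompactlyBounded {2}` ⟹ abc for `ρ`-balanced, `2`-tame triples (logarithmic form).**
For every `ε > 0` and `0 < ρ ≤ 1/2` there is `C` with `log c ≤ (1+ε)·log rad(abc) + C` for every abc
triple with `a, b > ρ·c` and `2^{v₂(a)}, 2^{v₂(b)}, 2^{v₂(c)} ≤ ρ⁻¹`: statement (ii) applied to the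
annulus compactly bounded subset with support `{∞, 2}` (`vojtaIneq_farFromCusps_two`) at `d = 1`,
read through the abc dictionary `ht(a/c) = log c`, `log-diff = 0`, `log-cond = log rad(abc)`.
[cite: MochizukiGenEll2010, Thm 2.1 (ii) p.11] -/
theorem log_le_of_abcCompactlyBounded_two (h : ABCCompactlyBounded ({2} : Finset ℕ))
    {ρ : ℝ} (h0 : 0 < ρ) (h2 : ρ ≤ 1 / 2) {ε : ℝ} (hε : 0 < ε) :
    ∃ C : ℝ, ∀ a b c : ℕ, IsABCTriple a b c → ρ * c < a → ρ * c < b →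
      (2 : ℝ) ^ padicValNat 2 a ≤ ρ⁻¹ → (2 : ℝ) ^ padicValNat 2 b ≤ ρ⁻¹ →
      (2 : ℝ) ^ padicValNat 2 c ≤ ρ⁻¹ →
      Real.log c ≤ (1 + ε) * Real.log (rad a b c) + C := by
  obtain ⟨K, hK⟩ := vojtaIneq_farFromCusps_two h one_pos hε h0 h2
  refine ⟨K, fun a b c ht hca hcb h2a h2b h2c => ?_⟩
  have hmem : ratPoint ((a : ℚ) / c) ∈
      {P : NFPoint | P.FarFromCusps ({2} : Finset ℕ) ρ} ∩ UPle 1 :=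
    ⟨farFromCusps_ratPoint_triple ht h0 h2 hca hcb h2a h2b h2c, ratPoint_triple_mem ht⟩
  have hineq := hK _ hmem
  simp only at hineq
  rw [ht_ratPoint_triple ht, logDiff_ratPoint, logCond_ratPoint_triple ht, zero_add] at hineq
  linarith

/-- **`ABCCompactlyBounded {2}` ⟹ abc for `ρ`-balanced, `2`-tame triples (the summit's
multiplicative form `c < C · rad(abc)^{1+ε}` on that family).** [cite: MochizukiGenEll2010, Thm 2.1 (ii) p.11] -/
theorem abc_tame_of_abcCompactlyBounded_two (h : ABCCompactlyBounded ({2} : Finset ℕ))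
    {ρ : ℝ} (h0 : 0 < ρ) (h2 : ρ ≤ 1 / 2) {ε : ℝ} (hε : 0 < ε) :
    ∃ C : ℝ, 0 < C ∧ ∀ a b c : ℕ, IsABCTriple a b c → ρ * c < a → ρ * c < b →
      (2 : ℝ) ^ padicValNat 2 a ≤ ρ⁻¹ → (2 : ℝ) ^ padicValNat 2 b ≤ ρ⁻¹ →
      (2 : ℝ) ^ padicValNat 2 c ≤ ρ⁻¹ →
      (c : ℝ) < C * ((rad a b c : ℕ) : ℝ) ^ (1 + ε) := by
  obtain ⟨K, hK⟩ := log_le_of_abcCompactlyBounded_two h h0 h2 hε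
  refine ⟨Real.exp K + 1, by positivity, fun a b c ht hca hcb h2a h2b h2c => ?_⟩
  have hineq := hK a b c ht hca hcb h2a h2b h2c
  have hc0 : (0 : ℝ) < c := by
    have : 0 < c := by obtain ⟨ha, -, habc, -⟩ := ht; omega
    exact_mod_cast this
  have hr0 : (0 : ℝ) < (rad a b c : ℝ) := by
    have : 0 < rad a b c := by
      rw [rad_def]; exact Nat.pos_of_ne_zero UniqueFactorizationMonoid.radical_ne_zero
    exact_mod_cast this
  have hexp : (c : ℝ) ≤ Real.exp K * (rad a b c : ℝ) ^ (1 + ε) := by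
    have e1 : (c : ℝ) = Real.exp (Real.log c) := (Real.exp_log hc0).symm
    have e2 : ((rad a b c : ℕ) : ℝ) ^ (1 + ε) = Real.exp (Real.log (rad a b c) * (1 + ε)) :=
      Real.rpow_def_of_pos hr0 _
    rw [e1, e2, ← Real.exp_add]
    apply Real.exp_le_exp.mpr
    linarith
  have hpow : 0 < ((rad a b c : ℕ) : ℝ) ^ (1 + ε) := Real.rpow_pos_of_pos hr0 _
  calc (c : ℝ) ≤ Real.exp K * (rad a b c : ℝ) ^ (1 + ε) := hexp
    _ < (Real.exp K + 1) * (rad a b c : ℝ) ^ (1 + ε) := by nlinarith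

/-! ## The family is infinite -/

/-- `v₂(4m+1) = 0`. [folklore] -/
private theorem padicValNat_two_four_mul_add_one (m : ℕ) : padicValNat 2 (4 * m + 1) = 0 :=
  padicValNat.eq_zero_of_not_dvd (by omega)

/-- `v₂(8m+3) = 0`. [folklore] -/
private theorem padicValNat_two_eight_mul_add_three (m : ℕ) : padicValNat 2 (8 * m + 3) = 0 :=
  padicValNat.eq_zero_of_not_dvd (by omega)

/-- `v₂(4m+2) = 1`. [folklore] -/
private theorem padicValNat_two_four_mul_add_two (m : ℕ) : padicValNat 2 (4 * m + 2) = 1 := by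
  have h : 4 * m + 2 = 2 * (2 * m + 1) := by ring
  rw [h, padicValNat.mul (by norm_num) (by omega), padicValNat.self (by norm_num),
    padicValNat.eq_zero_of_not_dvd (by omega)]

/-- **`ABCCompactlyBounded {2}` along an explicit infinite family**: statement (ii) at `Σ = {2}`
implies the abc inequality `log(8m+3) ≤ (1+ε)·log rad((4m+1)(4m+2)(8m+3)) + C` for all `m`, with one
constant `C = C(ε)` — the triple `(4m+1, 4m+2, 8m+3)` being `1/4`-balanced and `2`-tame
(`v₂(4m+1) = v₂(8m+3) = 0`, `v₂(4m+2) = 1`) for every `m`, with `c = 8m+3` unbounded. So the typed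
hypothesis of `GenEllTwo` has abc-type content on infinitely many points (contrast audit A-Sd2-F1,
where a non-prime support made the hypothesis vacuous). [cite: MochizukiGenEll2010, Thm 2.1 (ii) p.11] -/
theorem log_le_family_of_abcCompactlyBounded_two (h : ABCCompactlyBounded ({2} : Finset ℕ))
    {ε : ℝ} (hε : 0 < ε) :
    ∃ C : ℝ, ∀ m : ℕ, Real.log ((8 * m + 3 : ℕ) : ℝ) ≤
      (1 + ε) * Real.log (rad (4 * m + 1) (4 * m + 2) (8 * m + 3)) + C := by
  obtain ⟨C, hC⟩ := log_le_of_abcCompactlyBounded_two h (ρ := 1 / 4) (by norm_num) (by norm_num) hε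
  refine ⟨C, fun m => hC _ _ _ ⟨by omega, by omega, by omega, ?_⟩ ?_ ?_ ?_ ?_ ?_⟩
  · have hm : 4 * m + 2 = (4 * m + 1) + 1 := by ring
    rw [hm]
    exact Nat.coprime_self_add_right.mpr (Nat.coprime_one_right _)
  · push_cast; linarith
  · push_cast; linarith
  · rw [padicValNat_two_four_mul_add_one]; norm_num
  · rw [padicValNat_two_four_mul_add_two]; norm_num
  · rw [padicValNat_two_eight_mul_add_three]; norm_num

end Literature.NumberTheory.DiophantineGeometry.GenEll

end
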